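import Summits.HodgeConjecture.HodgeConjecture.Theorems.LinearSystemTorelliLocalTubeSpanFrameLiftBasic
import Summits.HodgeConjecture.HodgeConjecture.Theorems.LinearSystemTorelliLocalTubeSpanUnimodularPencil

/-!
# Route LinearSystemTorelli — crux `LocalTubeSpan` (stmt-HodgeConjecture-2490): Janssen's Lemma 2.7 (partners generate)

Helper file (`--supports stmt-HodgeConjecture-2490`, line `Sketch` of the crux chain, cycle 8,
continuation lead c7; the registered stub `stub_partnersGenerate`, worker A2).

**Janssen's Lemma 2.7** in Schnell's form ([Schnell2010] §7, proof of Lemma 11: "`V` is already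
generated by the smaller set `Δ₁ = {δ ∈ Δ : ⟨δ₁, δ⟩ = 1 or δ = δ₁}`"): for a skew-symmetric
vanishing lattice `Δ` of an alternating form `B` and any `u ∈ Δ`, the lattice `ℤΔ` is generated by
`u` together with the PARTNERS `{δ ∈ Δ : ⟨u, δ⟩ = 1}` of `u` — granting, as a hypothesis, the
pencil Euclid of the neighbouring stub `stub_planeEuclid` (every vector with integral pairings
against a unimodular pair `u, w` is moved into `u^⊥` by some element of the group `⟨T_u, T_w⟩`).

Proof (`localTubeSpan_partnersGenerate`).  Let `M₁ = ℤu + Σ_δ ℤδ` (partners `δ`).  `M₁ ⊆ ℤΔ` is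
clear.  Conversely `M₁` is `Γ_Δ`-stable, whence it contains the orbit `Δ = Γ_Δ · u` of `u ∈ M₁`.
Writing `P(a)` for "`⟨x, a⟩ a ∈ M₁` for all `x ∈ M₁`" (equivalently `T_a^{±1} M₁ ⊆ M₁`):
* a partner `w ∈ Δ` of `u` exists (a pair `⟨δ₁, δ₂⟩ = 1`, transitivity `g δ₁ = u`, `w = g δ₂`,
  isometry of `Γ_Δ`);
* `P(a)` holds trivially for `a ∈ Δ ∩ M₁` (integrality of `B` on `ℤΔ`), e.g. for `u` and `w`, so
  every element of `⟨T_u, T_w⟩` maps `M₁` into itself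
  (`localTubeSpan_closure_map_mem_of_transvections`);
* `P(ε)` for `ε ∈ Δ ∩ u^⊥`: `T_ε` maps a partner `δ` to `δ - ⟨δ, ε⟩ε ∈ Δ`, again a partner since
  `⟨u, ε⟩ = 0`, so `⟨x, ε⟩ ε ∈ M₁` for every generator `x` and hence for all `x ∈ M₁`
  (`localTubeSpan_smul_mem_span_int_of_generators`);
* `P(ε)` for every `ε ∈ Δ`: some `g ∈ ⟨T_u, T_w⟩` moves `ε` to `ε' = g ε ∈ Δ ∩ u^⊥` (the
  hypothesis), and `⟨x, ε⟩ ε = g⁻¹ (⟨g x, ε'⟩ ε') ∈ M₁` (isometry; `g^{±1} M₁ ⊆ M₁`);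
* hence `Γ_Δ M₁ ⊆ M₁`.

Elementary; no named facts; no `sorry`.

References: [Schnell2010] C. Schnell, *Primitive cohomology and the tube mapping*, Math. Z. 268
(2010), §7 (proof of Lemma 11); W. A. M. Janssen, *Skew-symmetric vanishing lattices and their
monodromy groups*, Math. Ann. 266 (1983), Lemma 2.7.
-/

-- `Summit.HodgeConjecture.HodgeConjecture.Theorems` is the mandated namespace (single-conjunct summit:
-- Sub = Summit), which `linter.dupNamespace` flags on every declaration; the lakefile turns the
-- linter off tree-wide (weak option), restated here so stand-alone elaboration is warning-free too.
set_option linter.dupNamespace false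

noncomputable section

open Literature.AlgebraicGeometry.HodgeTheory

namespace Summit.HodgeConjecture.HodgeConjecture.Theorems

/-! ### Two stability lemmas -/

section Stability

variable {V : Type} [AddCommGroup V] [Module ℚ V]

/-- If `⟨x, a⟩ a` lies in the lattice `ℤS` for every generator `x ∈ S`, then it does for every
`x ∈ ℤS` (the map `x ↦ ⟨x, a⟩ a` is additive). [folklore] -/
theorem localTubeSpan_smul_mem_span_int_of_generators (B : LinearMap.BilinForm ℚ V) (S : Set V)
    (a : V) (hS : ∀ x ∈ S, B x a • a ∈ Submodule.span ℤ S) {x : V}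
    (hx : x ∈ Submodule.span ℤ S) : B x a • a ∈ Submodule.span ℤ S := by
  induction hx using Submodule.span_induction with
  | mem x hx => exact hS x hx
  | zero =>
    rw [map_zero, LinearMap.zero_apply, zero_smul]
    exact zero_mem _
  | add x y _ _ hx hy =>
    rw [map_add, LinearMap.add_apply, add_smul]
    exact add_mem hx hy
  | smul n x _ hx =>
    rw [← Int.cast_smul_eq_zsmul ℚ n x, map_smul, LinearMap.smul_apply, smul_eq_mul, mul_smul,
      Int.cast_smul_eq_zsmul]
    exact Submodule.smul_mem _ n hx

/-- The subgroup of `GL(V)` generated by units acting as transvections `T_a` (`⟨a, a⟩ = 0`) maps a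
subgroup `N ≤ V` into itself as soon as `⟨x, a⟩ a ∈ N` for all `x ∈ N` and all these `a`
(`T_a^{±1} x = x ∓ ⟨x, a⟩ a`). [folklore] -/
theorem localTubeSpan_closure_map_mem_of_transvections (B : LinearMap.BilinForm ℚ V)
    (N : Submodule ℤ V) (S : Set (V →ₗ[ℚ] V)ˣ)
    (hS : ∀ t ∈ S, ∃ a : V, (t : V →ₗ[ℚ] V) = skewTransvection B a ∧ B a a = 0 ∧
      ∀ x ∈ N, B x a • a ∈ N)
    {g : (V →ₗ[ℚ] V)ˣ} (hg : g ∈ Subgroup.closure S) {x : V} (hx : x ∈ N) :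
    (g : V →ₗ[ℚ] V) x ∈ N := by
  induction hg using Subgroup.closure_induction'' generalizing x with
  | mem t ht =>
    obtain ⟨a, hta, -, hN⟩ := hS t ht
    rw [hta, skewTransvection_apply]
    exact sub_mem hx (hN x hx)
  | inv_mem t ht =>
    obtain ⟨a, hta, haa, hN⟩ := hS t ht
    rw [localTubeSpan_unit_inv_apply B hta haa]
    exact add_mem hx (hN x hx)
  | one => rwa [Units.val_one, Module.End.one_apply]
  | mul g h _ _ ihg ihh =>
    rw [Units.val_mul, Module.End.mul_apply]
    exact ihg (ihh hx)

end Stability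

/-! ### Janssen's Lemma 2.7 -/

section PartnersGenerate

variable {V : Type} [AddCommGroup V] [Module ℚ V]

/-- **Janssen's Lemma 2.7** ([Schnell2010] §7, proof of Lemma 11: "`V` is already generated by the
smaller set `Δ₁ = {δ ∈ Δ : ⟨δ₁, δ⟩ = 1 or δ = δ₁}`"), granting the pencil Euclid of the
neighbouring stub `stub_planeEuclid` as the hypothesis `heuclid`: for a skew-symmetric vanishing
lattice `Δ` of an alternating form and `u ∈ Δ`, the lattice `ℤΔ` is generated by `u` and the
partners `{δ ∈ Δ : ⟨u, δ⟩ = 1}` of `u`.  (The span `M₁` contains a partner `w`; for `ε ∈ Δ ∩ u^⊥`,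
`T_ε` maps partners to partners, so `T_ε^{±1} M₁ ⊆ M₁`; a general `ε ∈ Δ` is `g⁻¹ ε'` with
`ε' = g ε ∈ Δ ∩ u^⊥` and `g ∈ ⟨T_u, T_w⟩` preserving `M₁`; so `M₁` is `Γ_Δ`-stable and contains
`Δ = Γ_Δ u`.) [cite: Schnell2010, §7 proof of Lemma 11] -/
theorem localTubeSpan_partnersGenerate (B : LinearMap.BilinForm ℚ V) (hB : B.IsAlt) (Δ : Set V)
    (hΔ : IsSkewVanishingLattice B Δ)
    (heuclid : ∀ {u w : V}, B u w = 1 → ∀ (tu tw : (V →ₗ[ℚ] V)ˣ),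
      (∀ v, ((tu : (V →ₗ[ℚ] V)ˣ) : V →ₗ[ℚ] V) v = v - B v u • u) →
      (∀ v, ((tw : (V →ₗ[ℚ] V)ˣ) : V →ₗ[ℚ] V) v = v - B v w • w) →
      ∀ ε : V, (∃ b : ℤ, B u ε = b) → (∃ c : ℤ, B w ε = c) →
        ∃ g ∈ Subgroup.closure ({tu, tw} : Set (V →ₗ[ℚ] V)ˣ),
          B u (((g : (V →ₗ[ℚ] V)ˣ) : V →ₗ[ℚ] V) ε) = 0)
    {u : V} (hu : u ∈ Δ) :
    Submodule.span ℤ (insert u {δ ∈ Δ | B u δ = 1}) = Submodule.span ℤ Δ := by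
  set M₁ : Submodule ℤ V := Submodule.span ℤ (insert u {δ ∈ Δ | B u δ = 1}) with hM₁
  have hsub : insert u {δ ∈ Δ | B u δ = 1} ⊆ Δ := Set.insert_subset hu fun δ hδ => hδ.1
  have hle : M₁ ≤ Submodule.span ℤ Δ := Submodule.span_mono hsub
  refine le_antisymm hle (Submodule.span_le.mpr ?_)
  -- the generators of `M₁`
  have huM : u ∈ M₁ := Submodule.subset_span (Set.mem_insert u _)
  have hpartner : ∀ δ ∈ Δ, B u δ = 1 → δ ∈ M₁ := fun δ hδ h1 =>
    Submodule.subset_span (Set.mem_insert_of_mem u ⟨hδ, h1⟩)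
  -- integrality of `B` on `M₁ × Δ`
  have hint : ∀ x ∈ M₁, ∀ δ ∈ Δ, ∃ n : ℤ, B x δ = n := fun x hx δ hδ =>
    localTubeSpan_exists_int_eq_of_mem_span_int B Δ δ (fun y hy => hΔ.integral y hy δ hδ) (hle hx)
  -- the units `T_a ∈ GL(V)`, `a ∈ V`
  obtain ⟨T, hTval⟩ : ∃ T : V → (V →ₗ[ℚ] V)ˣ,
      ∀ a, ((T a : (V →ₗ[ℚ] V)ˣ) : V →ₗ[ℚ] V) = skewTransvection B a :=
    ⟨fun a => LinearMap.GeneralLinearGroup.ofLinearEquiv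
        (skewTransvectionEquiv B (hB.self_eq_zero a)), fun a => rfl⟩
  have hTapply : ∀ a v, ((T a : (V →ₗ[ℚ] V)ˣ) : V →ₗ[ℚ] V) v = v - B v a • a := fun a v => by
    rw [hTval, skewTransvection_apply]
  have hTmem : ∀ a ∈ Δ, T a ∈ transvectionGroup B Δ := fun a ha =>
    Subgroup.subset_closure ⟨a, ha, hTval a⟩
  -- (a) a partner `w` of `u`
  obtain ⟨δ₁, hδ₁, δ₂, hδ₂, h12⟩ := hΔ.exists_pair
  obtain ⟨g₀, hg₀, hg₀u⟩ := hΔ.transitive δ₁ hδ₁ u hu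
  obtain ⟨w, hwΔ, huw⟩ : ∃ w ∈ Δ, B u w = 1 :=
    ⟨(g₀ : V →ₗ[ℚ] V) δ₂, hΔ.stable g₀ hg₀ δ₂ hδ₂, by
      rw [← hg₀u, localTubeSpan_transvectionGroup_isometry B hB Δ hg₀, h12]⟩
  have hwM : w ∈ M₁ := hpartner w hwΔ huw
  -- `P a` := "`⟨x, a⟩ a ∈ M₁` for all `x ∈ M₁`"; trivial for `a ∈ Δ ∩ M₁`
  have hP_of_mem : ∀ a ∈ Δ, a ∈ M₁ → ∀ x ∈ M₁, B x a • a ∈ M₁ := by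
    intro a haΔ haM x hx
    obtain ⟨n, hn⟩ := hint x hx a haΔ
    rw [hn, Int.cast_smul_eq_zsmul]
    exact M₁.smul_mem n haM
  -- (b) `P ε` for `ε ∈ Δ ∩ u^⊥`: `T_ε` maps partners to partners
  have hP_orth : ∀ ε ∈ Δ, B u ε = 0 → ∀ x ∈ M₁, B x ε • ε ∈ M₁ := by
    intro ε hε huε x hx
    refine localTubeSpan_smul_mem_span_int_of_generators B _ ε (fun y hy => ?_) hx
    rcases Set.mem_insert_iff.mp hy with hyu | ⟨hyΔ, huy⟩
    · rw [hyu, huε, zero_smul]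
      exact zero_mem _
    · have hTy : y - B y ε • ε ∈ Δ := by
        have h := hΔ.stable _ (hTmem ε hε) y hyΔ
        rwa [hTapply] at h
      have hTy1 : B u (y - B y ε • ε) = 1 := by
        rw [map_sub, map_smul, smul_eq_mul, huy, huε, mul_zero, sub_zero]
      have h := sub_mem (hpartner y hyΔ huy) (hpartner _ hTy hTy1)
      rwa [sub_sub_cancel] at h
  -- (c) `P ε` for every `ε ∈ Δ`: conjugate into `u^⊥` by `⟨T_u, T_w⟩`
  have hP : ∀ ε ∈ Δ, ∀ x ∈ M₁, B x ε • ε ∈ M₁ := by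
    intro ε hε
    obtain ⟨g, hg, hg0⟩ := heuclid huw (T u) (T w) (hTapply u) (hTapply w) ε
      (hΔ.integral u hu ε hε) (hΔ.integral w hwΔ ε hε)
    have hH : Subgroup.closure ({T u, T w} : Set (V →ₗ[ℚ] V)ˣ) ≤ transvectionGroup B Δ := by
      rw [Subgroup.closure_le]
      rintro t ht
      rcases ht with rfl | rfl
      exacts [hTmem u hu, hTmem w hwΔ]
    have hgΓ : g ∈ transvectionGroup B Δ := hH hg
    have hε' : (g : V →ₗ[ℚ] V) ε ∈ Δ := hΔ.stable g hgΓ ε hε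
    -- `⟨T_u, T_w⟩` maps `M₁` into itself
    have hpres : ∀ h ∈ Subgroup.closure ({T u, T w} : Set (V →ₗ[ℚ] V)ˣ), ∀ x ∈ M₁,
        (h : V →ₗ[ℚ] V) x ∈ M₁ := fun h hh x hx =>
      localTubeSpan_closure_map_mem_of_transvections B M₁ {T u, T w} (by
        rintro t ht
        rcases ht with rfl | rfl
        · exact ⟨u, hTval u, hB.self_eq_zero u, hP_of_mem u hu huM⟩
        · exact ⟨w, hTval w, hB.self_eq_zero w, hP_of_mem w hwΔ hwM⟩) hh hx
    intro x hx
    have h1 : B ((g : V →ₗ[ℚ] V) x) ((g : V →ₗ[ℚ] V) ε) • (g : V →ₗ[ℚ] V) ε ∈ M₁ :=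
      hP_orth _ hε' hg0 _ (hpres g hg x hx)
    have h2 : (g : V →ₗ[ℚ] V) (B x ε • ε) ∈ M₁ := by
      rw [map_smul, ← localTubeSpan_transvectionGroup_isometry B hB Δ hgΓ x ε]
      exact h1
    have h3 := hpres g⁻¹ (inv_mem hg) _ h2
    rwa [localTubeSpan_units_inv_apply_apply] at h3
  -- (d) `Γ_Δ` maps `M₁` into itself
  have hΓ : ∀ g ∈ transvectionGroup B Δ, ∀ x ∈ M₁, (g : V →ₗ[ℚ] V) x ∈ M₁ := fun g hg x hx =>
    localTubeSpan_closure_map_mem_of_transvections B M₁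
      {t | ∃ δ ∈ Δ, (t : V →ₗ[ℚ] V) = skewTransvection B δ}
      (fun t ht => by
        obtain ⟨δ, hδ, htδ⟩ := ht
        exact ⟨δ, htδ, hB.self_eq_zero δ, hP δ hδ⟩) hg hx
  -- (e) `Δ = Γ_Δ · u ⊆ M₁`
  intro δ hδ
  obtain ⟨g, hg, hgu⟩ := hΔ.transitive u hu δ hδ
  rw [← hgu]
  exact hΓ g hg u huM

end PartnersGenerate

end Summit.HodgeConjecture.HodgeConjecture.Theorems

end
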